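import Mathlib
import HarnessLib
import Literature.MathematicalPhysics.QuantumLattice.FermiRG.BGM2003Sectors
import Summits.HubbardSuperconductivity.HubbardSuperconductivity.Theorems.KLProgrammeH10TwoPointLimitPerturbedFermiRadiusAccelBand
import Summits.HubbardSuperconductivity.HubbardSuperconductivity.Theorems.KLProgrammeH10TwoPointLimitPerturbedFermiRadiusCurvature
import Summits.HubbardSuperconductivity.HubbardSuperconductivity.Theorems.KLProgrammeH10TwoPointLimitPerturbedCell
import Summits.HubbardSuperconductivity.HubbardSuperconductivity.Theorems.KLProgrammePerturbedFermiCurveDefs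

/-!
# Route `KLProgramme` — K1/K3 (stmt-HubbardSuperconductivity-19938 / 20437), located item «(L−3)-FRAME-UNIFORM-c», datum (u3), geometry half:
# BGM 2003's moving frame `(n⃗, τ⃗)` at a point of the perturbed Fermi curve, and the SECOND-ORDER normal deviation of the curve

Cell gate-hubbard-kl, seat p4 (C5a), g11.  Inputs of the explicit-constant sector box (BGM 2003 Lemma 7.3, hypothesis `h73` of
`FermiRG.BGM2003.lemma31_sectorCounting_of_constants`) for a root selection `u` of the perturbed curve `{ε₀ + δ = μ}` (`δ ∈ C²`, global bounds
`|δ| ≤ κ₀`, `‖Dδ‖ ≤ κ₁ < Dt_min`, `‖D²δ‖ ≤ κ₂`, `[μ − κ₀, μ + κ₀] ⊂ [a, b]`), in the lineage's coordinates `X_E = u cos`, `Y_E = u sin`, `X_E′, Y_E′`: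

* §1 `frame_decomp_VXE` — every `w ∈ ℝ²` is `((w₀Y_E′ − w₁X_E′)/s′)·n⃗ + ((w₀X_E′ + w₁Y_E′)/s′)·τ⃗` for BGM 2003's `unitNormal`/`unitTangent` of the chart
  `u₂ θ e := perturbedFermiRadius δ (μ+e) θ` at `e = 0` (`s′ = speed`), with `|coefficient_τ| ≤ 2‖w‖_∞`;
* §2 `abs_normalDeviation_le` — the curve's deviation from its tangent line in the NORMAL direction is second order:
  `|(X_E(θ) − X_E(θ_c))·Y_E′(θ_c) − (Y_E(θ) − Y_E(θ_c))·X_E′(θ_c)| ≤ 2 S_E A_E |θ − θ_c|²` (two mean-value steps on `abs_VXE_sub_VXE_le`);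
* §3 `abs_radius_sub_radius_le_of_levels` — two Fermi radii of `ε₀ + δ` on one ray at levels `μ`, `μ + e` differ by `≤ |e|/(Dt_min − κ₁)`.

Everything is PROVED; no definitions, no named facts.  References: BGM 2003 §7.1 (A1.6)–(A1.7), Lemma 7.3 (A1.13) [cite: BenfattoGiulianiMastropietro2003];
BGM 2006 §2.4 Lemma 2.1 [cite: BenfattoGiulianiMastropietro2006].
-/

noncomputable section

namespace Summit.HubbardSuperconductivity.HubbardSuperconductivity.Theorems.PerturbedFermiCurve

set_option linter.dupNamespace false -- summit = problem name (single-conjunct summit), D-0017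

open Real Set
open Literature.MathematicalPhysics.QuantumLattice Literature.MathematicalPhysics.QuantumLattice.BandSectorCounting
open Literature.MathematicalPhysics.QuantumLattice.FermiRG

/-! ## §1 BGM 2003's moving frame of the chart in the lineage's coordinates -/

/-- The chart's radius derivative at `e = 0` is `u′`. [folklore] -/
theorem radiusDeriv_chart_zero (δ : (Fin 2 → ℝ) → ℝ) (μ θ : ℝ) :
    BGM2003.radiusDeriv (fun ϑ e => perturbedFermiRadius δ (μ + e) ϑ) θ 0 = deriv (perturbedFermiRadius δ μ) θ := by
  simp only [BGM2003.radiusDeriv, add_zero]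

/-- The chart's speed at `e = 0` is `√(X_E′² + Y_E′²)`. [folklore] -/
theorem speed_chart_zero (δ : (Fin 2 → ℝ) → ℝ) (μ θ : ℝ) :
    BGM2003.speed (fun ϑ e => perturbedFermiRadius δ (μ + e) ϑ) θ 0 =
      Real.sqrt (VXE (perturbedFermiRadius δ μ) θ ^ 2 + VYE (perturbedFermiRadius δ μ) θ ^ 2) := by
  simp only [BGM2003.speed, BGM2003.radiusDeriv, add_zero, ← deriv_sq_add_sq_eq_VXE]

/-- The chart's Fermi point is `u(θ)·dir θ`. [folklore] -/
theorem fermiPoint_chart (δ : (Fin 2 → ℝ) → ℝ) (μ θ : ℝ) :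
    BGM2003.fermiPoint (fun ϑ e => perturbedFermiRadius δ (μ + e) ϑ) θ = perturbedFermiRadius δ μ θ • dir θ := by
  simp only [BGM2003.fermiPoint, BGM2003.levelPoint, add_zero]

/-- `e⃗_t(θ)₀ = −sin θ`. [folklore] -/
theorem tdir_apply_zero (θ : ℝ) : tdir θ 0 = -Real.sin θ := by simp [tdir]

/-- `e⃗_t(θ)₁ = cos θ`. [folklore] -/
theorem tdir_apply_one (θ : ℝ) : tdir θ 1 = Real.cos θ := by simp [tdir]

/-- BGM 2003's unit tangent of the chart, in coordinates: `τ⃗ = (X_E′, Y_E′)/s′`. [cite: BenfattoGiulianiMastropietro2003, §7.1 (A1.6)] -/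
theorem unitTangent_chart_apply (δ : (Fin 2 → ℝ) → ℝ) (μ θ : ℝ) :
    BGM2003.unitTangent (fun ϑ e => perturbedFermiRadius δ (μ + e) ϑ) θ 0 0 =
      (Real.sqrt (VXE (perturbedFermiRadius δ μ) θ ^ 2 + VYE (perturbedFermiRadius δ μ) θ ^ 2))⁻¹ * VXE (perturbedFermiRadius δ μ) θ ∧
    BGM2003.unitTangent (fun ϑ e => perturbedFermiRadius δ (μ + e) ϑ) θ 0 1 =
      (Real.sqrt (VXE (perturbedFermiRadius δ μ) θ ^ 2 + VYE (perturbedFermiRadius δ μ) θ ^ 2))⁻¹ * VYE (perturbedFermiRadius δ μ) θ := by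
  rw [BGM2003.unitTangent, speed_chart_zero, radiusDeriv_chart_zero]
  refine ⟨?_, ?_⟩
  · simp only [Pi.smul_apply, Pi.add_apply, smul_eq_mul, dir_zero, tdir_apply_zero, add_zero, VXE]
    ring
  · simp only [Pi.smul_apply, Pi.add_apply, smul_eq_mul, dir_one, tdir_apply_one, add_zero, VYE]

/-- BGM 2003's outgoing unit normal of the chart, in coordinates: `n⃗ = (Y_E′, −X_E′)/s′`. [cite: BenfattoGiulianiMastropietro2003, §7.1 (A1.7)] -/
theorem unitNormal_chart_apply (δ : (Fin 2 → ℝ) → ℝ) (μ θ : ℝ) :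
    BGM2003.unitNormal (fun ϑ e => perturbedFermiRadius δ (μ + e) ϑ) θ 0 0 =
      (Real.sqrt (VXE (perturbedFermiRadius δ μ) θ ^ 2 + VYE (perturbedFermiRadius δ μ) θ ^ 2))⁻¹ * VYE (perturbedFermiRadius δ μ) θ ∧
    BGM2003.unitNormal (fun ϑ e => perturbedFermiRadius δ (μ + e) ϑ) θ 0 1 =
      (Real.sqrt (VXE (perturbedFermiRadius δ μ) θ ^ 2 + VYE (perturbedFermiRadius δ μ) θ ^ 2))⁻¹ * (-VXE (perturbedFermiRadius δ μ) θ) := by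
  rw [BGM2003.unitNormal, speed_chart_zero, radiusDeriv_chart_zero]
  refine ⟨?_, ?_⟩
  · simp only [Pi.smul_apply, Pi.sub_apply, smul_eq_mul, dir_zero, tdir_apply_zero, add_zero, VYE]
    ring
  · simp only [Pi.smul_apply, Pi.sub_apply, smul_eq_mul, dir_one, tdir_apply_one, add_zero, VXE]
    ring

/-- **Frame decomposition**: for `s′ = √(X_E′² + Y_E′²) > 0`, every `w ∈ ℝ²` equals `((w₀Y_E′ − w₁X_E′)/s′)·n⃗ + ((w₀X_E′ + w₁Y_E′)/s′)·τ⃗`.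
[cite: BenfattoGiulianiMastropietro2003, §7.1 (A1.6)–(A1.7)] -/
theorem frame_decomp_VXE (δ : (Fin 2 → ℝ) → ℝ) (μ θ : ℝ)
    (hs : 0 < VXE (perturbedFermiRadius δ μ) θ ^ 2 + VYE (perturbedFermiRadius δ μ) θ ^ 2) (w : Fin 2 → ℝ) :
    w = ((w 0 * VYE (perturbedFermiRadius δ μ) θ - w 1 * VXE (perturbedFermiRadius δ μ) θ) /
          Real.sqrt (VXE (perturbedFermiRadius δ μ) θ ^ 2 + VYE (perturbedFermiRadius δ μ) θ ^ 2)) •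
        BGM2003.unitNormal (fun ϑ e => perturbedFermiRadius δ (μ + e) ϑ) θ 0 +
      ((w 0 * VXE (perturbedFermiRadius δ μ) θ + w 1 * VYE (perturbedFermiRadius δ μ) θ) /
          Real.sqrt (VXE (perturbedFermiRadius δ μ) θ ^ 2 + VYE (perturbedFermiRadius δ μ) θ ^ 2)) •
        BGM2003.unitTangent (fun ϑ e => perturbedFermiRadius δ (μ + e) ϑ) θ 0 := by
  obtain ⟨ht0, ht1⟩ := unitTangent_chart_apply δ μ θ
  obtain ⟨hn0, hn1⟩ := unitNormal_chart_apply δ μ θ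
  set VX := VXE (perturbedFermiRadius δ μ) θ with hVX
  set VY := VYE (perturbedFermiRadius δ μ) θ with hVY
  set sp := Real.sqrt (VX ^ 2 + VY ^ 2) with hsp
  have hsp0 : 0 < sp := Real.sqrt_pos.2 hs
  have hsp2 : sp ^ 2 = VX ^ 2 + VY ^ 2 := Real.sq_sqrt hs.le
  have hne : sp ≠ 0 := hsp0.ne'
  ext i
  rw [Pi.add_apply, Pi.smul_apply, Pi.smul_apply, smul_eq_mul, smul_eq_mul]
  fin_cases i
  · show w 0 = _ * BGM2003.unitNormal (fun ϑ e => perturbedFermiRadius δ (μ + e) ϑ) θ 0 0 +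
      _ * BGM2003.unitTangent (fun ϑ e => perturbedFermiRadius δ (μ + e) ϑ) θ 0 0
    rw [hn0, ht0]
    field_simp
    linear_combination (w 0) * hsp2
  · show w 1 = _ * BGM2003.unitNormal (fun ϑ e => perturbedFermiRadius δ (μ + e) ϑ) θ 0 1 +
      _ * BGM2003.unitTangent (fun ϑ e => perturbedFermiRadius δ (μ + e) ϑ) θ 0 1
    rw [hn1, ht1]
    field_simp
    linear_combination (w 1) * hsp2

/-- The tangential coefficient is at most `2‖w‖_∞` (`|X_E′|, |Y_E′| ≤ s′`). [folklore] -/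
theorem abs_tangentCoeff_le (δ : (Fin 2 → ℝ) → ℝ) (μ θ : ℝ)
    (hs : 0 < VXE (perturbedFermiRadius δ μ) θ ^ 2 + VYE (perturbedFermiRadius δ μ) θ ^ 2) (w : Fin 2 → ℝ) {R : ℝ}
    (hw : ∀ i, |w i| ≤ R) :
    |(w 0 * VXE (perturbedFermiRadius δ μ) θ + w 1 * VYE (perturbedFermiRadius δ μ) θ) /
        Real.sqrt (VXE (perturbedFermiRadius δ μ) θ ^ 2 + VYE (perturbedFermiRadius δ μ) θ ^ 2)| ≤ 2 * R := by
  set VX := VXE (perturbedFermiRadius δ μ) θ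
  set VY := VYE (perturbedFermiRadius δ μ) θ
  set sp := Real.sqrt (VX ^ 2 + VY ^ 2) with hsp
  have hsp0 : 0 < sp := Real.sqrt_pos.2 hs
  have hsp2 : sp ^ 2 = VX ^ 2 + VY ^ 2 := Real.sq_sqrt hs.le
  have hVX : |VX| ≤ sp := by
    rw [← Real.sqrt_sq_eq_abs]; exact Real.sqrt_le_sqrt (by nlinarith)
  have hVY : |VY| ≤ sp := by
    rw [← Real.sqrt_sq_eq_abs]; exact Real.sqrt_le_sqrt (by nlinarith)
  have hR : 0 ≤ R := (abs_nonneg _).trans (hw 0)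
  rw [abs_div, abs_of_pos hsp0, div_le_iff₀ hsp0]
  calc |w 0 * VX + w 1 * VY| ≤ |w 0 * VX| + |w 1 * VY| := abs_add_le _ _
    _ = |w 0| * |VX| + |w 1| * |VY| := by rw [abs_mul, abs_mul]
    _ ≤ R * sp + R * sp := add_le_add (mul_le_mul (hw 0) hVX (abs_nonneg _) hR) (mul_le_mul (hw 1) hVY (abs_nonneg _) hR)
    _ = 2 * R * sp := by ring

/-! ## §2 The normal deviation of the curve is second order -/

section Deviation

variable {a b : ℝ} (B : BandBounds a b) {δ : (Fin 2 → ℝ) → ℝ} (hδs : ContDiff ℝ 2 δ)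
  {κ₀ κ₁ κ₂ μ : ℝ} (hδ : ∀ k : Fin 2 → ℝ, |δ k| ≤ κ₀) (hlo : a ≤ μ - κ₀) (hhi : μ + κ₀ ≤ b)
  (hκ : ∀ k : Fin 2 → ℝ, ‖fderiv ℝ δ k‖ ≤ κ₁) (hκ₁ : κ₁ < B.Dtmin) (hκ₂ : ∀ k : Fin 2 → ℝ, ‖fderiv ℝ (fderiv ℝ δ) k‖ ≤ κ₂)
  {u : ℝ → ℝ} (hu : ∀ θ, IsBandFermiRadius (μ - δ (u θ • dir θ)) θ (u θ))
include B hδs hδ hlo hhi hκ hκ₁ hκ₂ hu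

/-- **Second-order normal deviation** of the perturbed curve from its point `θ_c`, read against the velocity there:
`|(X_E(θ) − X_E(θ_c))·Y_E′(θ_c) − (Y_E(θ) − Y_E(θ_c))·X_E′(θ_c)| ≤ 2 S_E A_E (θ − θ_c)²`. [cite: BenfattoGiulianiMastropietro2003, §7.1 Lemma 7.3 (A1.13)] -/
theorem abs_normalDeviation_le (θc θ : ℝ) :
    |(XE u θ - XE u θc) * VYE u θc - (YE u θ - YE u θc) * VXE u θc| ≤
      2 * (B.smax + κ₁ * (π * Real.sqrt 2 + 2 * B.smax) / (B.Dtmin - κ₁)) *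
        (((4 + κ₂) * (B.smax + κ₁ * (π * Real.sqrt 2 + 2 * B.smax) / (B.Dtmin - κ₁)) ^ 2 +
            (8 + 2 * κ₁) * ((4 + κ₁) * (π * Real.sqrt 2) / (B.Dtmin - κ₁)) + (4 + κ₁) * (π * Real.sqrt 2)) / (B.Dtmin - κ₁) +
          2 * ((4 + κ₁) * (π * Real.sqrt 2) / (B.Dtmin - κ₁)) + π * Real.sqrt 2) * (θ - θc) ^ 2 := by
  have h2ne : (2 : WithTop ℕ∞) ≠ 0 := by norm_num
  set SE := B.smax + κ₁ * (π * Real.sqrt 2 + 2 * B.smax) / (B.Dtmin - κ₁) with hSE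
  set AE := ((4 + κ₂) * (B.smax + κ₁ * (π * Real.sqrt 2 + 2 * B.smax) / (B.Dtmin - κ₁)) ^ 2 +
            (8 + 2 * κ₁) * ((4 + κ₁) * (π * Real.sqrt 2) / (B.Dtmin - κ₁)) + (4 + κ₁) * (π * Real.sqrt 2)) / (B.Dtmin - κ₁) +
          2 * ((4 + κ₁) * (π * Real.sqrt 2) / (B.Dtmin - κ₁)) + π * Real.sqrt 2 with hAE
  have hδ' : ∀ k : Fin 2 → ℝ, (∀ i, |k i| ≤ π) → |δ k| ≤ κ₀ := fun k _ => hδ k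
  have hκ' : ∀ k : Fin 2 → ℝ, (∀ i, |k i| ≤ π) → ‖fderiv ℝ δ k‖ ≤ κ₁ := fun k _ => hκ k
  have hud : Differentiable ℝ u := differentiable_of_isRoot B hδs h2ne hδ' hlo hhi hκ' hκ₁ hu
  obtain ⟨hvx, hvy⟩ := abs_VXE_le B hδs h2ne hδ' hlo hhi hκ' hκ₁ hu θc
  rw [← hSE] at hvx hvy
  have hSE0 : 0 ≤ SE := (abs_nonneg _).trans hvx
  -- the deviation function and its derivative
  set f : ℝ → ℝ := fun ϑ => (XE u ϑ - XE u θc) * VYE u θc - (YE u ϑ - YE u θc) * VXE u θc with hf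
  have hfd : ∀ ϑ, HasDerivAt f (VXE u ϑ * VYE u θc - VYE u ϑ * VXE u θc) ϑ := by
    intro ϑ
    have h := (((hasDerivAt_XE (hud ϑ)).sub_const (XE u θc)).mul_const (VYE u θc)).sub
      (((hasDerivAt_YE (hud ϑ)).sub_const (YE u θc)).mul_const (VXE u θc))
    exact h
  have hf0 : f θc = 0 := by simp [hf]
  -- |f′(ϑ)| ≤ 2 S_E A_E |ϑ − θc|
  have hfd_le : ∀ ϑ, |VXE u ϑ * VYE u θc - VYE u ϑ * VXE u θc| ≤ 2 * SE * AE * |ϑ - θc| := by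
    intro ϑ
    obtain ⟨hx, hy⟩ := abs_VXE_sub_VXE_le B hδs hδ hlo hhi hκ hκ₁ hκ₂ hu ϑ θc
    rw [← hAE] at hx hy
    have e : VXE u ϑ * VYE u θc - VYE u ϑ * VXE u θc =
        (VXE u ϑ - VXE u θc) * VYE u θc - (VYE u ϑ - VYE u θc) * VXE u θc := by ring
    rw [e]
    have hAE0 : 0 ≤ AE * |ϑ - θc| := le_trans (abs_nonneg _) hx
    calc |(VXE u ϑ - VXE u θc) * VYE u θc - (VYE u ϑ - VYE u θc) * VXE u θc|
        ≤ |(VXE u ϑ - VXE u θc) * VYE u θc| + |(VYE u ϑ - VYE u θc) * VXE u θc| := abs_sub _ _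
      _ = |VXE u ϑ - VXE u θc| * |VYE u θc| + |VYE u ϑ - VYE u θc| * |VXE u θc| := by rw [abs_mul, abs_mul]
      _ ≤ AE * |ϑ - θc| * SE + AE * |ϑ - θc| * SE :=
          add_le_add (mul_le_mul hx hvy (abs_nonneg _) hAE0) (mul_le_mul hy hvx (abs_nonneg _) hAE0)
      _ = 2 * SE * AE * |ϑ - θc| := by ring
  -- `A_E ≥ 0`
  have hAE0 : 0 ≤ AE := by
    have h := (abs_VXE_sub_VXE_le B hδs hδ hlo hhi hκ hκ₁ hκ₂ hu (θc + 1) θc).1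
    rw [← hAE] at h
    have h0 : (0 : ℝ) ≤ AE * |θc + 1 - θc| := (abs_nonneg _).trans h
    rwa [add_sub_cancel_left, abs_one, mul_one] at h0
  -- mean value on the segment
  have hseg : ∀ ϑ ∈ Set.uIcc θc θ, ‖deriv f ϑ‖ ≤ 2 * SE * AE * |θ - θc| := by
    intro ϑ hϑ
    rw [(hfd ϑ).deriv, Real.norm_eq_abs]
    refine (hfd_le ϑ).trans (mul_le_mul_of_nonneg_left (Set.abs_sub_left_of_mem_uIcc hϑ) (by positivity))
  have h := Convex.norm_image_sub_le_of_norm_deriv_le (s := Set.uIcc θc θ) (fun ϑ _ => (hfd ϑ).differentiableAt) hseg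
    (convex_uIcc θc θ) (left_mem_uIcc) (right_mem_uIcc)
  rw [hf0, sub_zero, Real.norm_eq_abs, Real.norm_eq_abs] at h
  calc |f θ| ≤ 2 * SE * AE * |θ - θc| * |θ - θc| := h
    _ = 2 * SE * AE * (θ - θc) ^ 2 := by rw [mul_assoc, ← sq, sq_abs]

/-! ## §3 Two Fermi radii on one ray at nearby levels -/

omit hδs hκ₂ in
/-- **Radii at two levels**: if `t₁` is a Fermi radius of `ε₀ + δ` at level `μ` and `t₂` at level `μ + e` on the same ray, then
`|t₂ − t₁| ≤ |e|/(Dt_min − κ₁)` (provided `[μ + e − κ₀, μ + e + κ₀] ⊂ [a, b]` as well). [cite: BenfattoGiulianiMastropietro2006, §2.4 Lemma 2.1] -/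
theorem abs_radius_sub_radius_le_of_levels {θ t₂ e : ℝ} (hdiff : ∀ k, DifferentiableAt ℝ δ k)
    (hlo' : a ≤ μ + e - κ₀) (hhi' : μ + e + κ₀ ≤ b)
    (ht₂ : IsBandFermiRadius (μ + e - δ (t₂ • dir θ)) θ t₂) :
    |t₂ - u θ| ≤ |e| / (B.Dtmin - κ₁) := by
  have hδ' : ∀ k : Fin 2 → ℝ, (∀ i, |k i| ≤ π) → |δ k| ≤ κ₀ := fun k _ => hδ k
  have hκ' : ∀ k : Fin 2 → ℝ, (∀ i, |k i| ≤ π) → ‖fderiv ℝ δ k‖ ≤ κ₁ := fun k _ => hκ k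
  have ht₁ := hu θ
  have hden : 0 < B.Dtmin - κ₁ := sub_pos.2 hκ₁
  have hL := radialLipschitz_of_fderiv_le (fun k _ => hdiff k) hκ' θ
  have hI₁ : u θ ∈ Icc 0 (π / ‖dir θ‖) := mem_Icc_exit_iff.2 ht₁.1
  have hI₂ : t₂ ∈ Icc 0 (π / ‖dir θ‖) := mem_Icc_exit_iff.2 ht₂.1
  have hlev₁ : rayDispersion (θ, u θ) = μ - δ (u θ • dir θ) := ht₁.2
  have hlev₂ : rayDispersion (θ, t₂) = μ + e - δ (t₂ • dir θ) := ht₂.2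
  have hm₁ := shiftedLevel_mem_Icc ht₁ hδ' hlo hhi
  have hm₂ := shiftedLevel_mem_Icc ht₂ hδ' hlo' hhi'
  rw [le_div_iff₀ hden]
  rcases le_total (u θ) t₂ with h12 | h21
  · have hgrow := Dtmin_mul_sub_le_rayDispersion_sub B ht₁.1.1 h12 ht₂.1.2 (by rw [hlev₁]; exact hm₁.1) (by rw [hlev₂]; exact hm₂.2)
    rw [hlev₁, hlev₂] at hgrow
    have hδL := hL t₂ (u θ) hI₂ hI₁
    rw [abs_of_nonneg (sub_nonneg.2 h12)] at hδL
    have h1 := (abs_le.1 hδL).1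
    have h2 := le_abs_self e
    have e1 : |t₂ - u θ| * (B.Dtmin - κ₁) = B.Dtmin * (t₂ - u θ) - κ₁ * (t₂ - u θ) := by
      rw [abs_of_nonneg (sub_nonneg.2 h12)]; ring
    rw [e1]
    linarith
  · have hgrow := Dtmin_mul_sub_le_rayDispersion_sub B ht₂.1.1 h21 ht₁.1.2 (by rw [hlev₂]; exact hm₂.1) (by rw [hlev₁]; exact hm₁.2)
    rw [hlev₁, hlev₂] at hgrow
    have hδL := hL (u θ) t₂ hI₁ hI₂
    rw [abs_of_nonneg (sub_nonneg.2 h21)] at hδL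
    have h1 := (abs_le.1 hδL).1
    have h2 := neg_le_abs e
    have e1 : |t₂ - u θ| * (B.Dtmin - κ₁) = B.Dtmin * (u θ - t₂) - κ₁ * (u θ - t₂) := by
      rw [abs_sub_comm, abs_of_nonneg (sub_nonneg.2 h21)]; ring
    rw [e1]
    linarith

end Deviation

end Summit.HubbardSuperconductivity.HubbardSuperconductivity.Theorems.PerturbedFermiCurve

end
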